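import Mathlib.RingTheory.AlgebraicIndependent.Transcendental
import Mathlib.RingTheory.AlgebraicIndependent.AlgebraicClosure
import Mathlib.Analysis.Complex.IsIntegral
import Literature.Barriers.KontsevichZagierPeriods.GrothendieckPeriodConjectureDependence
import Literature.Barriers.Schanuel.AlgebraicIndependenceOfLogarithmsProofs
import Literature.NumberTheory.Transcendental.BakerLogarithmsConclusion
import Literature.NumberTheory.Transcendental.KZProductIdeal
import Literature.NumberTheory.Transcendental.KZKernelConjectureForms
import Literature.NumberTheory.Transcendental.KontsevichZagierProofs
import Mathlib.RingTheory.Localization.Integral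
import HarnessLib

/-!
# Barrier (Kontsevich–Zagier): the open consequent `TwoPiILogAlgIndep` — status and proved frontier

Sibling proof file of `GrothendieckPeriodConjectureDependence.lean`, about its named statement
`Literature.Barriers.KontsevichZagierPeriods.TwoPiILogAlgIndep`
(`∀ q : ℚ, 1 < q → AlgebraicIndependent ℚ ![2πi, log q]`), the consequent of the strength
barrier `kzConjecture_implies_twoPiI_log_algIndep`.

## Status of the statement (why there is no `TwoPiILogAlgIndep_holds`)

The source prints the statement as a *prediction* of an open conjecture, not as a theorem:
"Exemple 10.3 (les logarithmes). Soit `q > 1` un nombre rationnel. … Comme le groupe de Galois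
motivique est de dimension 2, la conjecture des périodes de Grothendieck prédit que les nombres
`2πi` et `log q` sont algébriquement indépendants." [Fresan2024, Ex. 10.3, p. 139]. It is open:
`2πi = 2 log(−1)` and `log q` are `ℚ`-linearly independent logarithms of algebraic numbers, so
the statement is the case `n = 2` of the conjecture of algebraic independence of logarithms of
algebraic numbers, "Conjecture 1.1 … Let `λ₁, …, λₙ` be `ℚ`-linearly independent elements of `L`.
Then `λ₁, …, λₙ` are algebraically independent" [Waldschmidt2005, §1 Conj. 1.1] (tree:
`Literature.Barriers.Schanuel.AlgIndepLogarithms`, undischarged for the same reason, see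
`Literature.Barriers.Schanuel.AlgebraicIndependenceOfLogarithmsProofs`), and already its instance
`q = 2` exhibits two algebraically independent logarithms of algebraic numbers
(`algebraicIndependent_piI_log_two_of_twoPiILogAlgIndep` below), whereas "it is not even known
whether or not there exist two elements of `L` which are algebraically independent over `ℚ`"
[Roy1992, Introduction p. 22]. Hence the statement cannot be discharged from the literature
(CONVENTIONS §4: open conjectures stay `def … : Prop`, never a `theorem`); this file records,
sorry-free, what IS proved about it and where it sits among the tree's conjectures.

## What is proved here

Unconditionally — the proved content of [Fresan2024, Ex. 2.5 and Ex. 10.3]: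

* `transcendental_log_ratCast`, `irrational_log_ratCast` — for a rational `q > 0`, `q ≠ 1`,
  `log q` is transcendental ("D'après le théorème d'Hermite-Lindemann, un tel `β` non nul est
  transcendant" [Fresan2024, Ex. 2.5, p. 21]), from the tree's PROVED Hermite–Lindemann theorem
  `Literature.NumberTheory.Transcendental.transcendental_exp_holds` (through
  `Literature.Barriers.Schanuel.transcendental_of_isAlgebraic_cexp`).
* `linearIndependent_twoPiI_log` — `2πi` and `log q` are `ℚ`-linearly independent (imaginary and
  real parts).
* `linearIndependent_one_twoPiI_log` — `1, 2πi, log q` are `ℚ`-linearly independent: the part of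
  Example 10.3 that is a theorem (the extension `H¹(𝔾_m, {1, q})` of `ℚ(−1)` by `ℚ(0)` is not
  split, the motivic Galois group has dimension `2`): "[le premier cas signifierait] que `log(q)`
  peut s'écrire comme une combinaison linéaire à coefficients rationnels de `1` et de `2πi` … Or,
  comme `log(q)` est réel et irrationnel, ce n'est pas possible." [Fresan2024, Ex. 10.3, p. 139].
* `linearIndependent_algebraicClosure_one_twoPiI_log` — the strongest statement in print towards
  `TwoPiILogAlgIndep`: `1, 2πi, log q` are linearly independent over the field `ℚ̄` of algebraic
  numbers (Baker: "une combinaison linéaire à coefficients algébriques de logarithmes de nombres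
  algébriques non nuls est transcendante pourvu qu'elle ne soit pas nulle" [Fresan2024, Ex. 2.5]),
  from the tree's PROVED Baker theorem `Literature.NumberTheory.Transcendental.bakerFin_holds`
  [BakerTNT1975, Ch. 2 Thm 2.1].

Conditionally — the position of the statement:

* `twoPiILogAlgIndep_of_algIndepLogarithms` — `AlgIndepLogarithms → TwoPiILogAlgIndep` (the case
  `n = 2`, `λ = (2πi, log q)`, `e^λ = (1, q)` of [Waldschmidt2005, §1 Conj. 1.1]);
* `twoPiILogAlgIndep_of_schanuel` — hence Schanuel's conjecture (`∀ n, SchanuelRank n`, the body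
  of the summit `Schanuel`) implies it, through
  `Literature.Barriers.Schanuel.algIndepLogarithms_of_schanuel`;
* `algebraicIndependent_piI_log_two_of_twoPiILogAlgIndep` — conversely `TwoPiILogAlgIndep` (at
  `q = 2`, rescaling `2πi ↦ πi`) yields the algebraic independence of `iπ = log(−1)` and `log 2`,
  i.e. two algebraically independent logarithms of algebraic numbers, printed as unknown
  [Roy1992, Introduction p. 22] — the same consequent as
  `Literature.Barriers.Schanuel.algebraicIndependent_piI_log_two_of_algIndepLogarithms`.

The real form of the statement (added 2026-08-15, provefact triage of
`kzConjecture_implies_twoPiI_log_algIndep`):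

* `twoPiILogAlgIndep_iff_real` — `TwoPiILogAlgIndep ↔ ∀ q > 1, AlgebraicIndependent ℚ ![π, log q]`
  with `π, log q` REAL (`algebraicIndependent_pair_mul_iff`: rescaling one member of a pair by a
  non-zero algebraic number, here `2i`, preserves algebraic independence over `ℚ` — through the
  algebraic closure of `ℚ` in `ℂ`, Mathlib's `AlgebraicIndependent.algebraicClosure` and
  `restrictScalars`; `algebraicIndependent_ofReal_pair_iff`: `ℝ → ℂ`). This is the form the
  antecedent of the strength barrier `kzConjecture_implies_twoPiI_log_algIndep` can speak to: the
  tree's Kontsevich–Zagier calculus (`Literature.NumberTheory.Transcendental.KZ.IntegralRep`,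
  `IntegralRep.value : ℝ`) represents real numbers — a period's real and imaginary parts are
  represented separately [KontsevichZagier2001, §1.1] — and `π`, `log q` (not `2πi`) are values of
  rational integral representations. The implication itself is not proved in the tree: in print
  it is the chain "Conjecture 1 ⟺ the evaluation homomorphism `𝒫 → P` is an isomorphism"
  (asserted without proof [KontsevichZagier2001, §4.1]; "not identical", see
  [HuberWustholz2022, Rem. 13.2 (2)] and [HuberMullerStachPeriods2017, Rem. 13.1.8]) ⟹ the
  Grothendieck period conjecture for every Nori motive [HuberMullerStachPeriods2017, Prop. 13.2.6]
  ⟹ `dim G_mot(H¹(𝔾_m, {1, q})) = 2` [Fresan2024, Ex. 10.3], through the formal period algebra and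
  Nori's Tannakian torsor theorem, none of which the tree has ("the (known) fact that the number
  `π` is transcendental follows from this conjecture and Deligne's theory of weights"
  [KontsevichZagier2001, §4.1]).

The barrier reduced to a multiplicative invariant of the calculus (added 2026-08-15, second
provefact pass on `kzConjecture_implies_twoPiI_log_algIndep`; theorems only):

* `algebraicIndependent_int_value_of_kzKernel`, `algebraicIndependent_value_of_kzKernel` — the
  TRANSFER PRINCIPLE behind "Kontsevich–Zagier ⟹ Grothendieck": if `ker eval = relations`
  (`KZKernelConjecture`, equivalent to the rules form of Conjecture 1 by the proved
  `kzKernelConjecture_iff_isRational`) and `θ : KZ.FormalRep →+ A` is any additive invariant of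
  the calculus (`θ = 0` on `KZ.relations`) with values in a commutative (`ℚ`-)algebra that is
  multiplicative for the product of integral representations (`KZProduct.lean`,
  `KZProductIdeal.lean`: Fubini `KZ.eval_mul'`, the relations form an ideal), then algebraic
  independence of the symbols `θ[x k]` forces algebraic independence of the numbers
  `value (x k)`: a relation `P(values) = 0` is realised by a formal `ℤ`-combination `c` of nested
  products with `eval c = 0` (`exists_formalRep_eval_map_eq_aeval`), so `c ∈ relations`, so
  `θ c = P(θ-symbols) · θ[x j] = 0`. In print `θ` is the map to formal (motivic) periods and the
  conclusion is genericity of the comparison point: "Dire que l'application per est injective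
  (conjecture 10.6) équivaut donc à dire que l'évaluation des fonctions sur le torseur des
  périodes en le point comp est injective … on retrouve la conjecture 10.1"
  [Fresan2024, §10.4, pp. 147–148]; [HuberMullerStachPeriods2017, Prop. 13.2.6].
* `kzConjecture_implies_twoPiI_log_algIndep_of_exists_mulInvariant` (and `_of_mulInvariant`) —
  hence the barrier fact holds as soon as, for each rational `q > 1`, SOME such invariant `θ`
  makes `θ[rπ]`, `θ[r_log q]` algebraically independent for some representations of `π` and
  `log q`. This isolates exactly what a discharge must import from the theory of motives and
  what the tree lacks: the period map from `KZ.FormalRep` to the formal period algebra (sound for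
  the four moves of `KZCalculus.lean` — not in print for this calculus, cf.
  [HuberMullerStachPeriods2017, Rem. 13.1.8], [HuberWustholz2022, Rem. 13.2 (2)]) together with
  `dim G_mot(H¹(𝔾_m, {1, q})) = 2` [Fresan2024, Ex. 10.3]. With `θ = KZ.eval` (sound and
  multiplicative) the hypothesis is the consequent itself, so nothing is smuggled: the fact stays
  a named `def` without `_holds`.
* `kzConjecture_implies_twoPiI_log_algIndep_iff_kernelForm`, `…_of_twoPiILogAlgIndep`,
  `…_of_algIndepLogarithms`, `…_of_schanuel`, `algebraicIndependent_piI_log_two_of_kz` — the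
  fact against the kernel form; its domination by the open statements `TwoPiILogAlgIndep`,
  `AlgIndepLogarithms` and by Schanuel's conjecture (body of the summit `Schanuel`); and its bite:
  with it, Conjecture 1 exhibits two algebraically independent logarithms of algebraic numbers
  (`iπ`, `log 2`), printed as unknown [Roy1992, Introduction p. 22].

## References

* [Fresan2024] J. Fresán, *Une introduction aux périodes*, Journées X-UPS 2019 (publ. 2024),
  Ex. 2.5 (p. 21), Ex. 10.3 (p. 139), §10.4 (Conj. 10.6, pp. 147–148).
* [Waldschmidt2005] M. Waldschmidt, *Variations on the six exponentials theorem* (2005), §1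
  Conjecture 1.1.
* [Roy1992] D. Roy, *Matrices whose coefficients are linear forms in logarithms*, J. Number
  Theory 41 (1992), Introduction p. 22.
* [BakerTNT1975] A. Baker, *Transcendental Number Theory* (1975), Ch. 2 Theorem 2.1.
* [KontsevichZagier2001] M. Kontsevich, D. Zagier, *Periods* (2001), §1.1, §1.2 Conjecture 1,
  §4.1.
* [HuberMullerStachPeriods2017] A. Huber, S. Müller-Stach, *Periods and Nori motives*,
  Ergebnisse 65, Springer (2017), Rem. 13.1.8, Conj. 13.2.1, Prop. 13.2.6.
* [HuberWustholz2022] A. Huber, G. Wüstholz, *Transcendence and linear relations of 1-periods*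
  (2022), Rem. 13.2.

## Design notes

* Nothing of `GrothendieckPeriodConjectureDependence.lean` is restated or modified; this file
  only adds theorems (imports: the barrier file, the Schanuel barrier's proof file for
  `AlgIndepLogarithms` and Hermite–Lindemann, `BakerLogarithmsConclusion` for Baker's theorem).
* `log q` for `q : ℚ` is `Real.log (q : ℝ)` coerced to `ℂ`, exactly as in `TwoPiILogAlgIndep`.
* The transfer section imports `KZProductIdeal` (the product on `KZ.FormalRep`, `KZ.eval_mul'`),
  `KZKernelConjectureForms` (kernel form ⟺ rules form) and `KontsevichZagierProofs`
  (`isRealPeriod_log_of_one_le`: `log q` has a rational integral representation). `KZ.FormalRep` is only a non-unital,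
  non-associative ring, so monomials are realised as right-nested `List.foldr` products over the
  listed multiset of exponents, and the constant term is avoided by multiplying a relation by one
  variable (`X_j · P`); `ℤ`- and `ℚ`-algebraic independence agree (`ℚ = Frac ℤ`).
-/

noncomputable section

open Complex

namespace Literature.Barriers.KontsevichZagierPeriods

/-! ### Logarithms of rationals (Hermite–Lindemann) -/

/-- `e^{log q} = q` in `ℂ`, for a rational `q > 0`. [folklore] -/
theorem cexp_log_ratCast (q : ℚ) (hq : 0 < q) : cexp (Real.log q : ℂ) = (q : ℂ) := by
  rw [← Complex.ofReal_exp, Real.exp_log (by exact_mod_cast hq), Complex.ofReal_ratCast]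

/-- `e^{2πi} = 1` is algebraic: `2πi` is a logarithm of an algebraic number. [folklore] -/
theorem isAlgebraic_cexp_two_pi_mul_I : IsAlgebraic ℚ (cexp (2 * Real.pi * I)) := by
  rw [Complex.exp_two_pi_mul_I]
  exact isAlgebraic_one

/-- `e^{log q} = q` is algebraic for a rational `q > 0`: `log q` is a logarithm of an algebraic
number. [folklore] -/
theorem isAlgebraic_cexp_log_ratCast (q : ℚ) (hq : 0 < q) :
    IsAlgebraic ℚ (cexp (Real.log q : ℂ)) := by
  rw [cexp_log_ratCast q hq]
  simpa using isAlgebraic_algebraMap (R := ℚ) (A := ℂ) q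

/-- **`log q` is transcendental** for a rational `q > 0`, `q ≠ 1`: a non-zero logarithm of an
algebraic number is transcendental by the Hermite–Lindemann theorem ("D'après le théorème
d'Hermite-Lindemann, un tel `β` non nul est transcendant"), here the tree's proved
`Literature.NumberTheory.Transcendental.transcendental_exp_holds` through
`Literature.Barriers.Schanuel.transcendental_of_isAlgebraic_cexp`. [cite: Fresan2024, Ex. 2.5] -/
theorem transcendental_log_ratCast (q : ℚ) (hq : 0 < q) (hq1 : q ≠ 1) :
    Transcendental ℚ (Real.log q) := by
  have h0 : Real.log q ≠ 0 :=
    Real.log_ne_zero_of_pos_of_ne_one (by exact_mod_cast hq) (by exact_mod_cast hq1)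
  have hC : Transcendental ℚ ((Real.log q : ℝ) : ℂ) :=
    Literature.Barriers.Schanuel.transcendental_of_isAlgebraic_cexp
      (isAlgebraic_cexp_log_ratCast q hq) (by exact_mod_cast h0)
  exact (transcendental_algebraMap_iff (R := ℚ) (A := ℂ) Complex.ofReal_injective).mp hC

/-- **`log q` is irrational** for a rational `q > 0`, `q ≠ 1` ("comme `log(q)` est réel et
irrationnel"), from `transcendental_log_ratCast`. [cite: Fresan2024, Ex. 10.3] -/
theorem irrational_log_ratCast (q : ℚ) (hq : 0 < q) (hq1 : q ≠ 1) : Irrational (Real.log q) :=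
  (transcendental_log_ratCast q hq hq1).irrational

/-! ### Linear independence over `ℚ` (the proved content of Example 10.3) -/

/-- For real `a ≠ 0` and `b ≠ 0`, the complex numbers `a·i` and `b` are `ℚ`-linearly independent
(imaginary and real parts). [folklore] -/
theorem linearIndependent_ofReal_mul_I_ofReal {a b : ℝ} (ha : a ≠ 0) (hb : b ≠ 0) :
    LinearIndependent ℚ ![(a : ℂ) * I, (b : ℂ)] := by
  rw [LinearIndependent.pair_iff]
  intro s t hst
  have hre := congrArg Complex.re hst
  have him := congrArg Complex.im hst
  simp only [Complex.add_re, Complex.add_im, Complex.smul_re, Complex.smul_im, Complex.mul_re,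
    Complex.mul_im, Complex.ofReal_re, Complex.ofReal_im, Complex.I_re, Complex.I_im,
    Complex.zero_re, Complex.zero_im, mul_zero, mul_one, sub_zero, add_zero,
    zero_add, smul_zero] at hre him
  constructor
  · rw [Rat.smul_def, mul_eq_zero] at him
    rcases him with h | h
    · exact_mod_cast h
    · exact absurd h ha
  · rw [Rat.smul_def, mul_eq_zero] at hre
    rcases hre with h | h
    · exact_mod_cast h
    · exact absurd h hb

/-- For real `a ≠ 0` and irrational `b`, the complex numbers `1, a·i, b` are `ℚ`-linearly
independent: a relation `r + s·a·i + t·b = 0` forces `s = 0` (imaginary part) and then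
`r + t·b = 0` with `b` irrational, so `t = 0` and `r = 0`. [folklore] -/
theorem linearIndependent_one_ofReal_mul_I_ofReal {a b : ℝ} (ha : a ≠ 0) (hb : Irrational b) :
    LinearIndependent ℚ ![(1 : ℂ), (a : ℂ) * I, (b : ℂ)] := by
  rw [Fintype.linearIndependent_iff]
  intro g hg
  rw [Fin.sum_univ_three] at hg
  simp only [Matrix.cons_val_zero, Matrix.cons_val_one, Matrix.cons_val_two, Matrix.head_cons,
    Matrix.tail_cons, Fin.isValue] at hg
  have hre := congrArg Complex.re hg
  have him := congrArg Complex.im hg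
  simp only [Complex.add_re, Complex.add_im, Complex.smul_re, Complex.smul_im, Complex.mul_re,
    Complex.mul_im, Complex.ofReal_re, Complex.ofReal_im, Complex.I_re, Complex.I_im,
    Complex.one_re, Complex.one_im, Complex.zero_re, Complex.zero_im, mul_zero, mul_one,
    sub_zero, add_zero, zero_add, smul_zero] at hre him
  -- now `him : g 1 • a = 0` and `hre : g 0 • 1 + g 2 • b = 0` (in `ℝ`)
  rw [Rat.smul_def, mul_eq_zero] at him
  rw [Rat.smul_def, Rat.smul_def, mul_one] at hre
  have h1 : g 1 = 0 := by
    rcases him with h | h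
    · exact_mod_cast h
    · exact absurd h ha
  have h2 : g 2 = 0 := by
    by_contra h2
    apply hb
    refine ⟨-(g 0) / g 2, ?_⟩
    have h2' : ((g 2 : ℚ) : ℝ) ≠ 0 := by exact_mod_cast h2
    push_cast
    rw [div_eq_iff h2']
    linear_combination -hre
  have h0 : g 0 = 0 := by
    have h2' : ((g 2 : ℚ) : ℝ) = 0 := by exact_mod_cast h2
    rw [h2', zero_mul, add_zero] at hre
    exact_mod_cast hre
  intro i
  fin_cases i
  · exact h0
  · exact h1
  · exact h2

/-- **`2πi` and `log q` are `ℚ`-linearly independent** for a rational `q > 1` (`2πi` is purely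
imaginary, `log q > 0` is real). [folklore] -/
theorem linearIndependent_twoPiI_log (q : ℚ) (hq : 1 < q) :
    LinearIndependent ℚ ![(2 * Real.pi * I : ℂ), (Real.log q : ℂ)] := by
  have hlog : Real.log q ≠ 0 := (Real.log_pos (by exact_mod_cast hq)).ne'
  have h2pi : (2 * Real.pi : ℝ) ≠ 0 := by positivity
  have h := linearIndependent_ofReal_mul_I_ofReal h2pi hlog
  convert h using 2
  push_cast
  ring

/-- **`1, 2πi, log q` are `ℚ`-linearly independent** for a rational `q > 1` — the proved content
of Example 10.3: the motive `H¹(𝔾_m, {1, q})`, an extension of `ℚ(−1)` by `ℚ(0)`, is not split,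
for otherwise "`log(q)` peut s'écrire comme une combinaison linéaire à coefficients rationnels de
`1` et de `2πi` … Or, comme `log(q)` est réel et irrationnel, ce n'est pas possible" (so the
motivic Galois group is the full group of matrices `(1 a; 0 b)`, of dimension `2`). Proof:
imaginary part, then the irrationality of `log q` (`irrational_log_ratCast`, Hermite–Lindemann).
[cite: Fresan2024, Ex. 10.3] -/
theorem linearIndependent_one_twoPiI_log (q : ℚ) (hq : 1 < q) :
    LinearIndependent ℚ ![(1 : ℂ), (2 * Real.pi * I : ℂ), (Real.log q : ℂ)] := by
  have hirr : Irrational (Real.log q) :=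
    irrational_log_ratCast q (zero_lt_one.trans hq) (ne_of_gt hq)
  have h2pi : (2 * Real.pi : ℝ) ≠ 0 := by positivity
  have h := linearIndependent_one_ofReal_mul_I_ofReal h2pi hirr
  convert h using 2
  push_cast
  ring

/-! ### Linear independence over `ℚ̄` (Baker) -/

/-- **`1, 2πi, log q` are linearly independent over `ℚ̄`** for a rational `q > 1` — the strongest
result in print towards `TwoPiILogAlgIndep`: all `ℚ̄`-linear relations among `1, 2πi, log q` are
trivial (Baker 1967: "une combinaison linéaire à coefficients algébriques de logarithmes de
nombres algébriques non nuls est transcendante pourvu qu'elle ne soit pas nulle"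
[cite: Fresan2024, Ex. 2.5]). From the tree's PROVED Baker theorem
`Literature.NumberTheory.Transcendental.bakerFin_holds` applied to the `ℚ`-linearly independent
logarithms `2πi, log q` of the algebraic numbers `1, q`. [cite: BakerTNT1975, Ch. 2 Thm 2.1] -/
theorem linearIndependent_algebraicClosure_one_twoPiI_log (q : ℚ) (hq : 1 < q) :
    LinearIndependent (algebraicClosure ℚ ℂ)
      ![(1 : ℂ), (2 * Real.pi * I : ℂ), (Real.log q : ℂ)] := by
  have halg : ∀ i, IsAlgebraic ℚ (cexp (![(2 * Real.pi * I : ℂ), (Real.log q : ℂ)] i)) := by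
    intro i
    fin_cases i
    · simpa using isAlgebraic_cexp_two_pi_mul_I
    · simpa using isAlgebraic_cexp_log_ratCast q (zero_lt_one.trans hq)
  have hB := Literature.NumberTheory.Transcendental.bakerFin_holds 2 _ halg
    (linearIndependent_twoPiI_log q hq)
  convert hB.comp _ (finSuccEquiv 2).injective using 1
  funext i
  refine Fin.cases ?_ (fun j => ?_) i
  · simp
  · simp only [Function.comp_apply, finSuccEquiv_succ, Option.elim_some, Matrix.cons_val_succ]

/-! ### Where the open statement sits: `Schanuel ⟹ AlgIndepLogarithms ⟹ TwoPiILogAlgIndep ⟹ two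
algebraically independent logarithms` -/

/-- **The conjecture of algebraic independence of logarithms implies `TwoPiILogAlgIndep`**
(PROVED): for a rational `q > 1`, `2πi` and `log q` are `ℚ`-linearly independent
(`linearIndependent_twoPiI_log`) logarithms of the algebraic numbers `e^{2πi} = 1`,
`e^{log q} = q`, so Conjecture 1.1 with `n = 2` gives their algebraic independence. This places
Fresán's prediction [cite: Fresan2024, Ex. 10.3] as an instance of
`Literature.Barriers.Schanuel.AlgIndepLogarithms`. [cite: Waldschmidt2005, §1 Conjecture 1.1] -/
theorem twoPiILogAlgIndep_of_algIndepLogarithms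
    (h : Literature.Barriers.Schanuel.AlgIndepLogarithms) : TwoPiILogAlgIndep := by
  intro q hq
  refine h 2 _ ?_ (linearIndependent_twoPiI_log q hq)
  intro i
  fin_cases i
  · simpa using isAlgebraic_cexp_two_pi_mul_I
  · simpa using isAlgebraic_cexp_log_ratCast q (zero_lt_one.trans hq)

/-- **Schanuel's conjecture implies `TwoPiILogAlgIndep`** (PROVED), composing
`Literature.Barriers.Schanuel.algIndepLogarithms_of_schanuel` ("According to Schanuel's
conjecture, elements of `L` which are linearly independent over `ℚ` should be algebraically
independent" [cite: Roy1992, Introduction p. 22]) with `twoPiILogAlgIndep_of_algIndepLogarithms`;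
the antecedent `∀ n, SchanuelRank n` is the body of the summit `Schanuel`.
[cite: Fresan2024, Ex. 10.3] -/
theorem twoPiILogAlgIndep_of_schanuel
    (hSC : ∀ n, Literature.NumberTheory.Transcendental.SchanuelRank n) : TwoPiILogAlgIndep :=
  twoPiILogAlgIndep_of_algIndepLogarithms
    (Literature.Barriers.Schanuel.algIndepLogarithms_of_schanuel hSC)

/-- **`TwoPiILogAlgIndep` yields two algebraically independent logarithms of algebraic numbers**
(PROVED): at `q = 2`, rescaling `2πi ↦ πi = ½ · 2πi` (algebraic independence is stable under
`xᵢ ↦ fᵢ(xᵢ)` for non-constant `fᵢ ∈ ℚ[X]`, Mathlib's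
`AlgebraicIndependent.polynomial_aeval_of_transcendental`), `iπ = log(−1)` and `log 2` are
algebraically independent over `ℚ` — a statement printed as unknown: "it is not even known
whether or not there exist two elements of `L` which are algebraically independent over `ℚ`".
This is why `TwoPiILogAlgIndep` has no `_holds`. [cite: Roy1992, Introduction p. 22] -/
theorem algebraicIndependent_piI_log_two_of_twoPiILogAlgIndep (h : TwoPiILogAlgIndep) :
    AlgebraicIndependent ℚ ![(Real.pi : ℂ) * I, (Real.log 2 : ℂ)] := by
  have h2 := h 2 one_lt_two
  have hf : ∀ i : Fin 2, Transcendental ℚ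
      (![Polynomial.C (1 / 2 : ℚ) * Polynomial.X, Polynomial.X] i) := by
    intro i
    fin_cases i
    · simp only [Fin.zero_eta, Fin.isValue, Matrix.cons_val_zero]
      refine Polynomial.transcendental _ ?_ ?_
      · rw [Polynomial.natDegree_C_mul_X _ (by norm_num)]
        exact one_ne_zero
      · rw [Polynomial.leadingCoeff_C_mul_X]
        exact mem_nonZeroDivisors_of_ne_zero (by norm_num)
    · simpa using Polynomial.transcendental_X ℚ
  convert h2.polynomial_aeval_of_transcendental hf using 1
  funext i
  fin_cases i
  · simp only [Fin.zero_eta, Fin.isValue, Matrix.cons_val_zero, map_mul, Polynomial.aeval_C,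
      Polynomial.aeval_X, eq_ratCast]
    push_cast
    ring
  · simp

/-! ### The real form of `TwoPiILogAlgIndep`

The Kontsevich–Zagier calculus of the tree is real-valued (`KZ.IntegralRep.value : ℝ`), and the
two periods of [Fresan2024, Ex. 10.3] have the rational integral representations
`π = ∫_{x²+y²≤1} dx dy`, `log q = ∫_1^q dx/x`; `2πi` is not real. We record, sorry-free, that the
consequent `TwoPiILogAlgIndep` is equivalent to the algebraic independence over `ℚ` of the real
numbers `π` and `log q` (`i` is algebraic), the statement a derivation from the rules form of
Conjecture 1 would have to reach. -/

/-- Rescaling the first member of a pair by a non-zero algebraic number preserves algebraic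
independence over `ℚ`: pass to the algebraic closure `K` of `ℚ` in `ℂ` (algebraic independence
over `ℚ` and over `K` agree, Mathlib's `AlgebraicIndependent.algebraicClosure` /
`restrictScalars`), where `x ↦ c·x` is a `K`-polynomial substitution. [folklore] -/
theorem algebraicIndependent_pair_mul_iff {c : ℂ} (hc : IsAlgebraic ℚ c) (hc0 : c ≠ 0)
    (a z : ℂ) : AlgebraicIndependent ℚ ![c * a, z] ↔ AlgebraicIndependent ℚ ![a, z] := by
  -- the algebraic closure of `ℚ` in `ℂ`, containing `c` and `c⁻¹`
  set K : IntermediateField ℚ ℂ := algebraicClosure ℚ ℂ with hK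
  have hcK : c ∈ K := mem_algebraicClosure_iff.2 hc
  have hinj : Function.Injective (algebraMap ℚ K) := (algebraMap ℚ K).injective
  -- general step: for `d ∈ K`, `![a, z]` independent over `ℚ` ⟹ `![d * a, z]` independent over `ℚ`
  have step : ∀ (d : K) (a z : ℂ), (d : ℂ) ≠ 0 → AlgebraicIndependent ℚ ![a, z] →
      AlgebraicIndependent ℚ ![(d : ℂ) * a, z] := by
    intro d a z hd h
    have hK' : AlgebraicIndependent K ![a, z] := h.algebraicClosure
    have hd' : (d : K) ≠ 0 := fun h0 => hd (by simp [h0])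
    have hf : ∀ i : Fin 2, Transcendental K
        (![Polynomial.C d * Polynomial.X, Polynomial.X] i) := by
      intro i
      fin_cases i
      · simp only [Fin.zero_eta, Fin.isValue, Matrix.cons_val_zero]
        refine Polynomial.transcendental _ ?_ ?_
        · rw [Polynomial.natDegree_C_mul_X _ hd']
          exact one_ne_zero
        · rw [Polynomial.leadingCoeff_C_mul_X]
          exact mem_nonZeroDivisors_of_ne_zero hd'
      · simpa using Polynomial.transcendental_X K
    have h2 := hK'.polynomial_aeval_of_transcendental hf
    have h3 : AlgebraicIndependent K ![(d : ℂ) * a, z] := by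
      convert h2 using 1
      funext i
      fin_cases i
      · simp only [Fin.zero_eta, Fin.isValue, Matrix.cons_val_zero, map_mul, Polynomial.aeval_C,
          Polynomial.aeval_X]
        rfl
      · simp
    exact h3.restrictScalars hinj
  constructor
  · intro h
    have hc0' : ((⟨c, hcK⟩⁻¹ : K) : ℂ) ≠ 0 := by
      simp [hc0]
    have := step (⟨c, hcK⟩⁻¹) (c * a) z hc0' h
    convert this using 1
    funext i
    fin_cases i
    · simp only [Fin.zero_eta, Fin.isValue, Matrix.cons_val_zero]
      rw [← mul_assoc]
      simp [hc0]
    · simp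
  · intro h
    exact step ⟨c, hcK⟩ a z hc0 h


/-- `![2πi, z]` is algebraically independent over `ℚ` iff `![π, z]` is (`2πi = (2i)·π` with `2i`
a non-zero algebraic number, Mathlib's `Complex.isIntegral_rat_I`). [folklore] -/
theorem algebraicIndependent_twoPiI_pair_iff (z : ℂ) :
    AlgebraicIndependent ℚ ![(2 * Real.pi * I : ℂ), z] ↔
      AlgebraicIndependent ℚ ![(Real.pi : ℂ), z] := by
  have h2I : IsAlgebraic ℚ (2 * I : ℂ) := by
    have h2 : IsIntegral ℚ (2 : ℂ) := by
      simpa using isIntegral_algebraMap (R := ℚ) (A := ℂ) (x := 2)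
    exact (h2.mul Complex.isIntegral_rat_I).isAlgebraic
  have h0 : (2 * I : ℂ) ≠ 0 := mul_ne_zero two_ne_zero I_ne_zero
  have e : (2 * Real.pi * I : ℂ) = (2 * I) * (Real.pi : ℂ) := by ring
  rw [e]
  exact algebraicIndependent_pair_mul_iff h2I h0 _ _

/-- A pair of real numbers is algebraically independent over `ℚ` in `ℝ` iff it is so in `ℂ`
(`ℝ → ℂ` is an injective `ℚ`-algebra map). [folklore] -/
theorem algebraicIndependent_ofReal_pair_iff (x y : ℝ) :
    AlgebraicIndependent ℚ ![(x : ℂ), (y : ℂ)] ↔ AlgebraicIndependent ℚ ![x, y] := by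
  have e : (![(x : ℂ), (y : ℂ)] : Fin 2 → ℂ) = (Complex.ofRealAm.restrictScalars ℚ) ∘ ![x, y] := by
    funext i
    fin_cases i <;> simp
  rw [e]
  exact ⟨fun h => h.of_comp _, fun h => h.map' Complex.ofReal_injective⟩

/-- **Real form of the open consequent.** `TwoPiILogAlgIndep` (`2πi`, `log q` algebraically
independent in `ℂ`) is equivalent to the algebraic independence over `ℚ` of the two REAL periods
`π` and `log q` (`q > 1` rational) — the form in which the tree's real-valued Kontsevich–Zagier
calculus (`Literature.NumberTheory.Transcendental.KZ.IntegralRep.value : ℝ`; a period's real and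
imaginary parts are represented separately [cite: KontsevichZagier2001, §1.1]) can address the
prediction "les nombres `2πi` et `log q` sont algébriquement indépendants"
[cite: Fresan2024, Ex. 10.3]: `π = ∫_{x²+y²≤1} dx dy` and `log q = ∫_1^q dx/x` are values of
rational integral representations, `2πi` is not real. Any derivation of the consequent of
`kzConjecture_implies_twoPiI_log_algIndep` from its antecedent (the rules form of Conjecture 1)
passes through this statement. -/
theorem twoPiILogAlgIndep_iff_real :
    TwoPiILogAlgIndep ↔ ∀ q : ℚ, 1 < q → AlgebraicIndependent ℚ ![Real.pi, Real.log q] := by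
  refine forall₂_congr fun q _ => ?_
  rw [algebraicIndependent_twoPiI_pair_iff, algebraicIndependent_ofReal_pair_iff]

/-! ### The transfer principle: injectivity of evaluation carries algebraic independence

[Fresan2024, §10.4]: Conjecture 1 in the form "l'application `per` est injective" (Conj. 10.6)
says that evaluation of the functions on the period torsor at the comparison point is injective,
i.e. that the point is generic, whence "le degré de transcendance … on retrouve la conjecture
10.1" (Grothendieck). Over the calculus of `KZCalculus.lean` the same algebra reads: under the
kernel form `KZKernelConjecture`, ANY additive invariant `θ` of the moves that is multiplicative
for the product of representations (`KZProduct.lean`) transfers algebraic independence from the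
symbols `θ[r]` to the numbers `value r`. The formal `ℤ`-combinations used are right-nested
products in the non-unital ring `KZ.FormalRep` (`List.foldr` over the listed multiset of
exponents); no unit is needed because a relation `P = 0` is first multiplied by a variable. -/

section Transfer

open Literature.NumberTheory.Transcendental MvPolynomial

variable {ι : Type*}

/-- Nested products in the (non-unital, non-associative) ring `KZ.FormalRep`: an additive map `θ`
which is multiplicative sends the right-nested product `[x k₁]·([x k₂]·(⋯·[x i]))` to the
product of the images. [folklore] -/
theorem map_foldr_of_mul {A : Type*} [CommRing A] (θ : KZ.FormalRep →+ A)
    (hmul : ∀ c d : KZ.FormalRep, θ (c * d) = θ c * θ d)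
    (x : ι → Σ n, KZ.IntegralRep n) (i : ι) (t : List ι) :
    θ (t.foldr (fun k acc => KZ.of (x k).2 * acc) (KZ.of (x i).2)) =
      ((i :: t).map fun k => θ (KZ.of (x k).2)).prod := by
  induction t with
  | nil => simp
  | cons k t ih =>
      rw [List.foldr_cons, hmul, ih]
      simp only [List.map_cons, List.prod_cons]
      ring

/-- The product of `f` over the listed multiset of a multi-exponent `d` is the monomial
`∏ₖ f(k)^{d k}`. [folklore] -/
theorem prod_map_toList_toMultiset {M : Type*} [CommMonoid M] (f : ι → M) (d : ι →₀ ℕ) :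
    ((Finsupp.toMultiset d).toList.map f).prod = d.prod fun k n => f k ^ n := by
  rw [← Multiset.prod_coe, ← Multiset.map_coe, Multiset.coe_toList, Finsupp.toMultiset_map,
    Finsupp.prod_toMultiset]
  exact Finsupp.prod_mapDomain_index (fun _ => pow_zero _) (fun _ _ _ => pow_add _ _ _)

/-- The nested product of the `[x k]` with multiplicities `d ≠ 0` (list the multiset of `d`,
multiply from the right in `KZ.FormalRep` starting from the head) is sent by an additive
multiplicative `θ` to the monomial `∏ₖ θ[x k]^{d k}`. [folklore] -/
theorem map_nestedProd_eq_prod {A : Type*} [CommRing A] (θ : KZ.FormalRep →+ A)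
    (hmul : ∀ c d : KZ.FormalRep, θ (c * d) = θ c * θ d)
    (x : ι → Σ n, KZ.IntegralRep n) {d : ι →₀ ℕ} (hd : d ≠ 0) :
    θ ((Finsupp.toMultiset d).toList.tail.foldr (fun k acc => KZ.of (x k).2 * acc)
        ((((Finsupp.toMultiset d).toList.head?).map fun i => KZ.of (x i).2).getD 0)) =
      d.prod fun k n => θ (KZ.of (x k).2) ^ n := by
  classical
  have hne : (Finsupp.toMultiset d).toList ≠ [] := by
    intro h0
    rw [Multiset.toList_eq_nil] at h0
    apply hd
    rw [← Finsupp.toMultiset_toFinsupp d, h0]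
    simp
  obtain ⟨i, t, hit⟩ := List.exists_cons_of_ne_nil hne
  rw [← prod_map_toList_toMultiset, hit]
  simp only [List.tail_cons, List.head?_cons, Option.map_some, Option.getD_some]
  exact map_foldr_of_mul θ hmul x i t

/-- **Formal combinations realising a polynomial without constant term.** For integral
representations `x k`, an additive multiplicative map `θ` on `KZ.FormalRep` and `Q ∈ ℤ[Xₖ]`
with no constant term, the formal `ℤ`-combination `c` of nested products of the `[x k]`
prescribed by `Q` satisfies `eval c = Q(value (x k))` — products of representations multiply
values (Fubini, `KZ.eval_mul'`), "the product of integrals is again an integral (Fubini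
formula)" [cite: KontsevichZagier2001, §4.1] — and `θ c = Q(θ[x k])`. -/
theorem exists_formalRep_eval_map_eq_aeval {A : Type*} [CommRing A] (θ : KZ.FormalRep →+ A)
    (hmul : ∀ c d : KZ.FormalRep, θ (c * d) = θ c * θ d)
    (x : ι → Σ n, KZ.IntegralRep n) (Q : MvPolynomial ι ℤ) (hQ : ∀ d ∈ Q.support, d ≠ 0) :
    ∃ c : KZ.FormalRep, KZ.eval c = MvPolynomial.aeval (fun k => (x k).2.value) Q ∧
      θ c = MvPolynomial.aeval (fun k => θ (KZ.of (x k).2)) Q := by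
  classical
  let m : (ι →₀ ℕ) → KZ.FormalRep := fun d =>
    (Finsupp.toMultiset d).toList.tail.foldr (fun k acc => KZ.of (x k).2 * acc)
      ((((Finsupp.toMultiset d).toList.head?).map fun i => KZ.of (x i).2).getD 0)
  refine ⟨∑ d ∈ Q.support, Q.coeff d • m d, ?_, ?_⟩
  · rw [map_sum, MvPolynomial.aeval_def, MvPolynomial.eval₂_eq]
    refine Finset.sum_congr rfl fun d hd => ?_
    rw [map_zsmul, zsmul_eq_mul]
    simp only [m]
    rw [map_nestedProd_eq_prod KZ.eval KZ.eval_mul' x (hQ d hd)]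
    simp [Finsupp.prod, KZ.eval_of]
  · rw [map_sum, MvPolynomial.aeval_def, MvPolynomial.eval₂_eq]
    refine Finset.sum_congr rfl fun d hd => ?_
    rw [map_zsmul, zsmul_eq_mul]
    simp only [m]
    rw [map_nestedProd_eq_prod θ hmul x (hQ d hd)]
    simp [Finsupp.prod]

/-- **Transfer of algebraic independence under the kernel form of Conjecture 1 (over `ℤ`).**
If `ker eval = relations` (`KZKernelConjecture`) and `θ : KZ.FormalRep →+ A` is an additive
invariant of the Kontsevich–Zagier calculus (`θ = 0` on `KZ.relations`), with values in a
commutative ring, multiplicative for the product of integral representations, then integral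
representations whose symbols `θ[x k]` are algebraically independent have algebraically
independent VALUES: a relation `P(values) = 0` gives `eval c = 0` for the formal combination
`c` realising `X_j · P` (`exists_formalRep_eval_map_eq_aeval`), hence `c ∈ relations`, hence
`0 = θ c = (X_j · P)(θ-symbols)`, hence `P = 0`. This is the algebra by which injectivity of the
evaluation of formal periods yields the Grothendieck period conjecture — "Dire que l'application
per est injective (conjecture 10.6) équivaut donc à dire que l'évaluation des fonctions sur le
torseur des périodes en le point comp est injective … on retrouve la conjecture 10.1"
[cite: Fresan2024, §10.4 (pp. 147-148)]; [cite: HuberMullerStachPeriods2017, Prop. 13.2.6] —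
written for the calculus of `KZCalculus.lean` and an arbitrary multiplicative invariant `θ`. -/
theorem algebraicIndependent_int_value_of_kzKernel (hK : KZKernelConjecture)
    {A : Type*} [CommRing A] (θ : KZ.FormalRep →+ A)
    (hrel : ∀ c ∈ KZ.relations, θ c = 0)
    (hmul : ∀ c d : KZ.FormalRep, θ (c * d) = θ c * θ d)
    (x : ι → Σ n, KZ.IntegralRep n)
    (hind : AlgebraicIndependent ℤ fun k => θ (KZ.of (x k).2)) :
    AlgebraicIndependent ℤ fun k => (x k).2.value := by
  classical
  rw [algebraicIndependent_iff] at hind ⊢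
  intro P hP
  rcases isEmpty_or_nonempty ι with hι | ⟨⟨j⟩⟩
  · obtain ⟨a, rfl⟩ : ∃ a : ℤ, P = C a := ⟨_, P.eq_C_of_isEmpty⟩
    have ha : (a : ℝ) = 0 := by simpa using hP
    have ha' : a = 0 := by exact_mod_cast ha
    simp [ha']
  · set Q : MvPolynomial ι ℤ := X j * P with hQdef
    have hQ : ∀ d ∈ Q.support, d ≠ 0 := by
      intro d hd h0
      subst h0
      rw [MvPolynomial.mem_support_iff, hQdef, MvPolynomial.coeff_X_mul'] at hd
      simp at hd
    obtain ⟨c, hce, hcθ⟩ := exists_formalRep_eval_map_eq_aeval θ hmul x Q hQ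
    have hQv : MvPolynomial.aeval (fun k => (x k).2.value) Q = 0 := by
      rw [hQdef, map_mul, hP, mul_zero]
    have hcrel : c ∈ KZ.relations := hK c (hce.trans hQv)
    have hQw : MvPolynomial.aeval (fun k => θ (KZ.of (x k).2)) Q = 0 :=
      hcθ.symm.trans (hrel c hcrel)
    have hQ0 : X j * P = 0 := hind Q hQw
    rcases mul_eq_zero.mp hQ0 with h | h
    · exact absurd h (X_ne_zero j)
    · exact h

/-- **Transfer of algebraic independence under the kernel form of Conjecture 1 (over `ℚ`).**
As `algebraicIndependent_int_value_of_kzKernel`, for a commutative `ℚ`-algebra `A` of symbols: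
algebraic independence over `ℚ` and over `ℤ` agree on both sides (`ℚ = Frac ℤ`; Mathlib's
`Algebra.IsAlgebraic.algebraicIndependent_iff`). [cite: Fresan2024, §10.4 (pp. 147-148)]
[cite: HuberMullerStachPeriods2017, Prop. 13.2.6] -/
theorem algebraicIndependent_value_of_kzKernel (hK : KZKernelConjecture)
    {A : Type*} [CommRing A] [Algebra ℚ A] (θ : KZ.FormalRep →+ A)
    (hrel : ∀ c ∈ KZ.relations, θ c = 0)
    (hmul : ∀ c d : KZ.FormalRep, θ (c * d) = θ c * θ d)
    (x : ι → Σ n, KZ.IntegralRep n)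
    (hind : AlgebraicIndependent ℚ fun k => θ (KZ.of (x k).2)) :
    AlgebraicIndependent ℚ fun k => (x k).2.value := by
  haveI : Algebra.IsAlgebraic ℤ ℚ := IsLocalization.isAlgebraic ℚ (nonZeroDivisors ℤ)
  have hZ : AlgebraicIndependent ℤ fun k => θ (KZ.of (x k).2) :=
    hind.restrictScalars (algebraMap ℤ ℚ).injective_int
  exact (Algebra.IsAlgebraic.algebraicIndependent_iff ℤ ℚ).1
    (algebraicIndependent_int_value_of_kzKernel hK θ hrel hmul x hZ)

end Transfer

/-! ### The barrier reduced to a multiplicative invariant separating `π` and `log q`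

What a discharge of `kzConjecture_implies_twoPiI_log_algIndep` must import from the theory of
motives, exactly: a period map `θ` on `KZ.FormalRep`, zero on the four move sets and
multiplicative, with values in an algebra of formal periods in which the symbols of `π` and
`log q` are algebraically independent (in print: `dim G_mot(H¹(𝔾_m, {1, q})) = 2`
[Fresan2024, Ex. 10.3]). The tree has no such map; with `θ = KZ.eval` the hypothesis is the
consequent itself. -/

section Reduction

open Literature.NumberTheory.Transcendental

universe u

/-- **The strength barrier follows from a multiplicative invariant of the calculus separating
`π` and `log q`.** If for every rational `q > 1` there are integral representations `rπ`, `rl`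
of `π` and `log q` and an additive invariant `θ : KZ.FormalRep →+ A` of the Kontsevich–Zagier
calculus (`θ = 0` on `KZ.relations`), with values in a commutative `ℚ`-algebra and
multiplicative for the product of representations, under which `θ[rπ]`, `θ[rl]` are
algebraically independent over `ℚ`, then the rules form of Conjecture 1 implies
`TwoPiILogAlgIndep`: rules form ⟺ kernel form (`kzKernelConjecture_iff_isRational`), transfer
(`algebraicIndependent_value_of_kzKernel`), real form of the consequent
(`twoPiILogAlgIndep_iff_real`). In print `θ` is the map to formal periods and the independence
of the symbols `[2πi]`, `[log q]` is "Comme le groupe de Galois motivique est de dimension 2, la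
conjecture des périodes de Grothendieck prédit que les nombres `2πi` et `log q` sont
algébriquement indépendants" [cite: Fresan2024, Ex. 10.3 (p. 139)]; the transfer is
[cite: Fresan2024, §10.4 (pp. 147-148)], [cite: HuberMullerStachPeriods2017, Prop. 13.2.6].
Neither the period map on `KZ.FormalRep` (soundness of the four moves of `KZCalculus.lean` in
formal periods is not in print for this calculus) nor the motivic Galois group exists in the
tree, which is why the fact itself keeps no `_holds`. -/
theorem kzConjecture_implies_twoPiI_log_algIndep_of_exists_mulInvariant
    (h : ∀ q : ℚ, 1 < q → ∃ (n m : ℕ) (rπ : KZ.IntegralRep n) (rl : KZ.IntegralRep m),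
        rπ.value = Real.pi ∧ rl.value = Real.log q ∧
        ∃ (A : Type u) (_ : CommRing A) (_ : Algebra ℚ A) (θ : KZ.FormalRep →+ A),
          (∀ c ∈ KZ.relations, θ c = 0) ∧ (∀ c d : KZ.FormalRep, θ (c * d) = θ c * θ d) ∧
          AlgebraicIndependent ℚ ![θ (KZ.of rπ), θ (KZ.of rl)]) :
    kzConjecture_implies_twoPiI_log_algIndep := by
  intro hkz
  have hK : KZKernelConjecture := kzKernelConjecture_iff_isRational.mpr hkz
  rw [twoPiILogAlgIndep_iff_real]
  intro q hq
  obtain ⟨n, m, rπ, rl, hπ, hl, A, _, _, θ, hrel, hmul, hind⟩ := h q hq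
  have key := algebraicIndependent_value_of_kzKernel hK θ hrel hmul
    (![⟨n, rπ⟩, ⟨m, rl⟩] : Fin 2 → Σ k, KZ.IntegralRep k) ?_
  · convert key using 1
    funext i
    fin_cases i
    · simp [hπ]
    · simp [hl]
  · convert hind using 1
    funext i
    fin_cases i <;> simp

/-- **One invariant for all `q`.** The same reduction for a single multiplicative invariant `θ`
of the calculus under which, for every rational `q > 1`, some representations of `π` and `log q`
have algebraically independent symbols — the shape of the period map to the formal period
algebra `P̃(ℚ)` of all motives over `ℚ` [cite: HuberMullerStachPeriods2017, Conj. 13.2.1 and Prop. 13.2.6]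
[cite: Fresan2024, Ex. 10.3 (p. 139)]. -/
theorem kzConjecture_implies_twoPiI_log_algIndep_of_mulInvariant
    {A : Type u} [CommRing A] [Algebra ℚ A] (θ : KZ.FormalRep →+ A)
    (hrel : ∀ c ∈ KZ.relations, θ c = 0)
    (hmul : ∀ c d : KZ.FormalRep, θ (c * d) = θ c * θ d)
    (h : ∀ q : ℚ, 1 < q → ∃ (n m : ℕ) (rπ : KZ.IntegralRep n) (rl : KZ.IntegralRep m),
        rπ.value = Real.pi ∧ rl.value = Real.log q ∧
          AlgebraicIndependent ℚ ![θ (KZ.of rπ), θ (KZ.of rl)]) :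
    kzConjecture_implies_twoPiI_log_algIndep := by
  refine kzConjecture_implies_twoPiI_log_algIndep_of_exists_mulInvariant.{u} fun q hq => ?_
  obtain ⟨n, m, rπ, rl, hπ, hl, hind⟩ := h q hq
  exact ⟨n, m, rπ, rl, hπ, hl, A, inferInstance, inferInstance, θ, hrel, hmul, hind⟩

/-- With `θ = KZ.eval` — sound (`KZ.relations_le_ker_eval_holds`) and multiplicative
(`KZ.eval_mul'`) — the hypothesis of `kzConjecture_implies_twoPiI_log_algIndep_of_mulInvariant`
is the real form of the consequent itself (`π = ∬_{x²+y²≤1} dx dy` is `KZ.piRep`,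
`log q = ∫_1^q dx/x` [cite: KontsevichZagier2001, §1.1]): the reduction asks for an invariant
FINER than evaluation only in so far as the consequent is open. -/
theorem eval_mulInvariant_hypothesis_iff :
    (∀ q : ℚ, 1 < q → ∃ (n m : ℕ) (rπ : KZ.IntegralRep n) (rl : KZ.IntegralRep m),
        rπ.value = Real.pi ∧ rl.value = Real.log q ∧
          AlgebraicIndependent ℚ ![KZ.eval (KZ.of rπ), KZ.eval (KZ.of rl)]) ↔
      ∀ q : ℚ, 1 < q → AlgebraicIndependent ℚ ![Real.pi, Real.log q] := by
  refine forall₂_congr fun q hq => ?_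
  constructor
  · rintro ⟨n, m, rπ, rl, hπ, hl, hind⟩
    simpa [KZ.eval_of, hπ, hl] using hind
  · intro hind
    obtain ⟨m, rl, -, hl⟩ := KZ.isRealPeriod_iff_exists_isRational_holds.mp
      (isRealPeriod_log_of_one_le hq.le)
    refine ⟨2, m, KZ.piRep, rl, KZ.piRep_value, hl, ?_⟩
    simpa [KZ.eval_of, KZ.piRep_value, hl] using hind

end Reduction

/-! ### The barrier against the other forms of Conjecture 1; domination; bite -/

section Forms

open Literature.NumberTheory.Transcendental

/-- **Kernel form.** The barrier fact is equivalently the same implication from the kernel form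
of Conjecture 1, `KZKernelConjecture` (`ker KZ.eval = KZ.relations` — the shape of "the
evaluation map `P̃(k) → P(k)` is bijective" [cite: HuberMullerStachPeriods2017, Conj. 13.2.1] and
of "Conjecture 10.6 (Kontsevich–Zagier). L'application per est injective"
[cite: Fresan2024, §10.4 Conjecture 10.6]), by the proved comparison
`kzKernelConjecture_iff_isRational`. -/
theorem kzConjecture_implies_twoPiI_log_algIndep_iff_kernelForm :
    kzConjecture_implies_twoPiI_log_algIndep ↔ (KZKernelConjecture → TwoPiILogAlgIndep) := by
  unfold kzConjecture_implies_twoPiI_log_algIndep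
  rw [kzKernelConjecture_iff_isRational]

/-- **Domination by the consequent.** The barrier fact is implied outright by the open statement
`TwoPiILogAlgIndep` (the antecedent is not used): as named-fact debt it is dominated by an open
conjecture [cite: Fresan2024, Ex. 10.3 (p. 139)] [cite: Waldschmidt2006, §4 (p. 446)]. -/
theorem kzConjecture_implies_twoPiI_log_algIndep_of_twoPiILogAlgIndep (h : TwoPiILogAlgIndep) :
    kzConjecture_implies_twoPiI_log_algIndep :=
  fun _ => h

/-- **Domination by the conjecture of algebraic independence of logarithms**
(`Literature.Barriers.Schanuel.AlgIndepLogarithms`, [cite: Waldschmidt2005, §1 Conjecture 1.1]),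
through `twoPiILogAlgIndep_of_algIndepLogarithms`. -/
theorem kzConjecture_implies_twoPiI_log_algIndep_of_algIndepLogarithms
    (h : Literature.Barriers.Schanuel.AlgIndepLogarithms) :
    kzConjecture_implies_twoPiI_log_algIndep :=
  fun _ => twoPiILogAlgIndep_of_algIndepLogarithms h

/-- **Domination by Schanuel's conjecture** (`∀ n, SchanuelRank n`, the body of the summit
`Schanuel`), through `twoPiILogAlgIndep_of_schanuel`: a proof of Schanuel's conjecture proves
this barrier fact about the Kontsevich–Zagier conjecture with the antecedent unused.
[cite: Roy1992, Introduction p. 22] -/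
theorem kzConjecture_implies_twoPiI_log_algIndep_of_schanuel
    (hSC : ∀ n, Literature.NumberTheory.Transcendental.SchanuelRank n) :
    kzConjecture_implies_twoPiI_log_algIndep :=
  fun _ => twoPiILogAlgIndep_of_schanuel hSC

/-- **The bite.** Under the printed implication, a proof of Conjecture 1 (rules form) exhibits
two algebraically independent logarithms of algebraic numbers, `iπ = log(−1)` and `log 2` —
"it is not even known whether or not there exist two elements of `L` which are algebraically
independent over `ℚ`" [cite: Roy1992, Introduction p. 22]; "it is not known that there exist
two algebraically independent logarithms of algebraic numbers" [cite: Waldschmidt2006, §4 (p. 446)]. -/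
theorem algebraicIndependent_piI_log_two_of_kz (h : kzConjecture_implies_twoPiI_log_algIndep)
    (hkz : ∀ ⦃n m : ℕ⦄ (r : KZ.IntegralRep n) (r' : KZ.IntegralRep m),
      r.IsRational → r'.IsRational → r.value = r'.value → KZ.Equivalent r r') :
    AlgebraicIndependent ℚ ![(Real.pi : ℂ) * I, (Real.log 2 : ℂ)] :=
  algebraicIndependent_piI_log_two_of_twoPiILogAlgIndep (h hkz)

end Forms

end Literature.Barriers.KontsevichZagierPeriods
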